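import Summits.HodgeConjecture.HodgeConjecture.Theorems.LinearSystemTorelliDefs
import Literature.AlgebraicGeometry.HodgeTheory.CorrespondenceActionOfGysin
import Literature.AlgebraicGeometry.HodgeTheory.ComplexOrientationDegreeFormulaHolds
import HarnessLib

/-!
# Line `ch0-null-correspondence-support`, stub F1 — the cohomological half of clause (K3): `[Γ_f]^* = f^*`

Crux `stmt-HodgeConjecture-1081` (`LinearSystemTorelli.MiddleDivisorSupport`), stub
`stub_correspondencePackagesExist` of `Summits/…/LinearSystemTorelliDefs`: the `C`-component of
clause (K3) `graphs` of `IsCorrespondencePackage`, with the Chow half dropped. For every smooth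
projective `X` of dimension `2p` there is a cohomological action of correspondences
`C : CorrespondenceAction (2p) X` (Voisin II (10.7), `[Z]^*(c) = pr_{1*}(pr_2^* c ∪ cl Z)`) such that
every endomorphism `f : X ⟶ X` has a `2p`-cycle `Γ_f` on `X × X` with `[Γ_f]^* = f^*` on every
`Hʳ(X(ℂ); ℂ)` (Fulton, *Intersection Theory*, Prop. 16.1.2 (c): "if `f : X → Y` is a morphism […]
`(Γ_f)^* = f^*`", for the graph `Γ_f` of Def. 16.1.1).

The action `C` is UNCONDITIONAL today: the Gysin / cycle-class formalism of the complex
orientations (`exists_gysinFormalism_isGysinHodgeCompatible_complexOrientation_holds`, a theorem), turned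
into a `CorrespondenceAction` by `GysinFormalism.correspondenceAction` from projective Hironaka
(`Resolution.Hironaka1964_projective_holds`) and Hodge models (`nonempty_hodgeModel_holds`), both
theorems. The cycle `Γ_f` is the prime cycle of the generic point `γ` of the image of the graph
embedding `(𝟙, f) : X ⟶ X ⊗ X` (a closed immersion, `X` being separated over `ℂ`); it is a
`2p`-cycle because a closed immersion preserves the dimension of point closures; and
`[Γ_f]^*(c) = pr_{1*}(pr_2^* c ∪ Γ_*1) = pr_{1*}Γ_*(Γ^* pr_2^* c ∪ 1) = (Γ ≫ pr₁)_*((Γ ≫ pr₂)^* c) = f^* c`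
by `cl[Γ(X)] = Γ_*(1)` (`GysinFormalism.cl_primeCycle`), the projection formula (`gysin_cup`) and
functoriality (`gysin_comp`, `gysin_id`), exactly as for the diagonal
(`GysinFormalism.corrAct_primeCycle_diagonal`, the case `f = 𝟙`).

## References

* [Fulton1998] W. Fulton, Intersection Theory, Def. 16.1.1 and Prop. 16.1.2 (c).
* [VoisinHodgeII2003] C. Voisin, Hodge Theory and Complex Algebraic Geometry II, §9.2.2 and proof of
  Thm. 10.17 (10.7).
* [Hartshorne1977] R. Hartshorne, Algebraic Geometry, II Cor. 4.2, II Ex. 3.20 and Ex. 4.8.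
-/

noncomputable section

-- `Summit.HodgeConjecture.HodgeConjecture.Theorems` is the mandated namespace (single-problem summit:
-- Problem = Summit), which `linter.dupNamespace` flags on every declaration; the lakefile turns the
-- linter off tree-wide (weak option), restated here so stand-alone elaboration is warning-free too.
set_option linter.dupNamespace false

namespace Summit.HodgeConjecture.HodgeConjecture.Theorems.Ch0Null

open CategoryTheory AlgebraicGeometry MonoidalCategory CartesianMonoidalCategory
open Literature.AlgebraicGeometry Literature.AlgebraicGeometry.HodgeTheory
open Literature.AlgebraicGeometry.Motives
open Literature.AlgebraicTopology.SingularHomology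

/-! ### The graph of an endomorphism of a smooth projective variety -/

/-- The graph `(𝟙, f) : X ⟶ X ⊗ Y` of a morphism to a smooth projective (hence separated) `Y` is a
closed immersion. [cite: Hartshorne1977, II Cor. 4.2 and Ex. 4.8] -/
theorem isClosedImmersion_graph_left {m : ℕ} {X Y : SchemeOver ℂ}
    (hY : IsSmoothProjective m Y) (f : X ⟶ Y) : IsClosedImmersion (lift (𝟙 X) f).left := by
  haveI : IsProper Y.hom := IsSmoothProjective.isProper_holds hY
  have h : (lift (𝟙 X) f).left ≫ (fst X Y).left = 𝟙 _ := by
    rw [← Over.comp_left, lift_fst]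
    rfl
  haveI : IsSeparated (fst X Y).left :=
    inferInstanceAs (IsSeparated (Limits.pullback.fst X.hom Y.hom))
  haveI : IsClosedImmersion ((lift (𝟙 X) f).left ≫ (fst X Y).left) := by
    rw [h]
    infer_instance
  exact IsClosedImmersion.of_comp _ (fst X Y).left

/-- The generic point of the graph `Γ_f(X) ⊆ X ⊗ Y` of a morphism from a smooth projective `n`-fold
to a smooth projective variety has dimension `n`: it is the image of the generic point of `X`
(of codimension `0`, hence of dimension `n`, Hartshorne II Ex. 3.20 (d)) under the closed immersion
`(𝟙, f)`, which preserves dimensions of point closures.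
[cite: Fulton1998, Def. 16.1.1] [cite: Hartshorne1977, II Ex. 3.20] -/
theorem height_eq_of_isGenericPoint_graph {n m : ℕ} {X Y : SchemeOver ℂ}
    (hX : IsSmoothProjective n X) (hY : IsSmoothProjective m Y) (f : X ⟶ Y) {γ : ↥(X ⊗ Y).left}
    (hγ : IsGenericPoint γ (Set.range (lift (𝟙 X) f).left.base)) : Order.height γ = n := by
  haveI := hX.smoothOfRelativeDimension
  haveI := hX.geometricallyIrreducible
  haveI : IrreducibleSpace ↥X.left := GeometricallyIrreducible.irreducibleSpace_of_subsingleton X.hom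
  haveI : IsClosedImmersion (lift (𝟙 X) f).left := isClosedImmersion_graph_left hY f
  have hη : IsGenericPoint ((lift (𝟙 X) f).left.base (genericPoint X.left))
      (Set.range (lift (𝟙 X) f).left.base) := by
    have h := (genericPoint_spec X.left).image (lift (𝟙 X) f).left.base.hom.continuous
    rwa [Set.image_univ, (lift (𝟙 X) f).left.isClosedEmbedding.isClosed_range.closure_eq] at h
  rw [hγ.eq hη, height_base_eq_of_isClosedImmersion' (lift (𝟙 X) f).left]
  -- `height + coheight = n` on the smooth irreducible `X` (Hartshorne II Ex. 3.20 (d))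
  have h := height_add_coheight_eq_of_smoothOfRelativeDimension X.hom n (genericPoint X.left)
  have hmax : Order.coheight (genericPoint X.left) = 0 := by
    rw [Order.coheight_eq_zero]
    intro b _
    exact Scheme.le_iff_specializes.mpr (genericPoint_specializes b)
  rwa [hmax, add_zero] at h

/-- The graph cycle `Γ_f = [Γ_f(X)]`, the prime cycle of the generic point of the image of
`(𝟙, f) : X ⟶ X ⊗ Y`, is an `n`-cycle on `X ⊗ Y` (`n = dim X`). [cite: Fulton1998, Def. 16.1.1] -/
theorem primeCycle_graph_mem_cyclesOfDim {n m : ℕ} {X Y : SchemeOver ℂ}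
    (hX : IsSmoothProjective n X) (hY : IsSmoothProjective m Y) (f : X ⟶ Y) {γ : ↥(X ⊗ Y).left}
    (hγ : IsGenericPoint γ (Set.range (lift (𝟙 X) f).left.base)) :
    primeCycle γ ∈ cyclesOfDim (X ⊗ Y).left n :=
  primeCycle_mem_cyclesOfDim (height_eq_of_isGenericPoint_graph hX hY f hγ)

/-- The image of the graph embedding has a generic point (it is the closure of the image of the
generic point of the irreducible `X`). [cite: Fulton1998, Def. 16.1.1] -/
theorem exists_isGenericPoint_graph {n m : ℕ} {X Y : SchemeOver ℂ}
    (hX : IsSmoothProjective n X) (hY : IsSmoothProjective m Y) (f : X ⟶ Y) :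
    ∃ γ : ↥(X ⊗ Y).left, IsGenericPoint γ (Set.range (lift (𝟙 X) f).left.base) := by
  haveI := hX.geometricallyIrreducible
  haveI : IrreducibleSpace ↥X.left := GeometricallyIrreducible.irreducibleSpace_of_subsingleton X.hom
  haveI : IsClosedImmersion (lift (𝟙 X) f).left := isClosedImmersion_graph_left hY f
  refine ⟨(lift (𝟙 X) f).left.base (genericPoint X.left), ?_⟩
  have h := (genericPoint_spec X.left).image (lift (𝟙 X) f).left.base.hom.continuous
  rwa [Set.image_univ, (lift (𝟙 X) f).left.isClosedEmbedding.isClosed_range.closure_eq] at h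

/-! ### `[Γ_f]^* = f^*` for the action of correspondences of a Gysin / cycle-class formalism -/

/-- **`[Γ_f]^* = f^*`** (Fulton Prop. 16.1.2 (c) on cohomology; Voisin II (10.7)): for any Gysin /
cycle-class formalism `G`, a morphism `f : X ⟶ Y` of smooth projective varieties and the prime cycle
`Γ_f` of the generic point `γ` of the graph `(𝟙, f)(X) ⊆ X ⊗ Y`,
`[Γ_f]^*(c) = pr_{X*}(pr_Y^* c ∪ Γ_*1) = pr_{X*}Γ_*(Γ^*pr_Y^* c ∪ 1) = (Γ ≫ pr_X)_*((Γ ≫ pr_Y)^* c) = f^* c`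
by `cl[Γ_f(X)] = Γ_*(1)`, the projection formula and functoriality of Gysin morphisms
(`Γ ≫ pr_X = 𝟙`, `Γ ≫ pr_Y = f`). The case `f = 𝟙` is `GysinFormalism.corrAct_primeCycle_diagonal`.
[cite: Fulton1998, Prop. 16.1.2 (c)] [cite: VoisinHodgeII2003, proof of Thm. 10.17 (10.7)] -/
theorem corrAct_primeCycle_graph (G : GysinFormalism) {n m : ℕ} {X Y : SchemeOver ℂ}
    (hX : IsSmoothProjective n X) (hY : IsSmoothProjective m Y) (f : X ⟶ Y) (k : ℕ)
    (γ : ↥(X ⊗ Y).left) (hγ : IsGenericPoint γ (Set.range (lift (𝟙 X) f).left.base))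
    (hn : primeCycle γ ∈ cyclesOfDim (X ⊗ Y).left n) :
    G.corrAct hX hY k ⟨primeCycle γ, hn⟩ = (complexBetti.map f k).hom := by
  haveI := isClosedImmersion_graph_left hY f
  have hXY := IsSmoothProjective.tensor_holds hX hY
  ext c
  rw [G.corrAct_apply, G.cl_primeCycle hX hXY (lift (𝟙 X) f) rfl γ hγ hn,
    ← G.gysin_cup hX hXY (lift (𝟙 X) f) (Nat.add_zero k)
      (show k + 2 * (n + m) = (k + 2 * m) + 2 * n by ring) _ rfl]
  rw [← CategoryTheory.comp_apply, ← complexBetti.map_comp, lift_snd, cupProduct_one,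
    ← LinearMap.comp_apply, ← G.gysin_comp hX hXY hX (lift (𝟙 X) f) (fst X Y)]
  simp only [lift_fst]
  rw [G.gysin_id hX k, LinearMap.id_apply]

/-- **`[Γ_f]^* = f^*` for the `CorrespondenceAction` of a Gysin / cycle-class formalism**: for every
smooth projective `n`-fold `X`, any formalism `G`, and any witnesses of projective Hironaka and of
Hodge models, every endomorphism `f` of `X` has an `n`-cycle `Γ_f` on `X × X` (its graph) acting as
`f^*` on every `Hʳ(X(ℂ); ℂ)` under `G.correspondenceAction`.
[cite: Fulton1998, Prop. 16.1.2 (c)] [cite: VoisinHodgeII2003, proof of Thm. 10.17 (10.7)] -/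
theorem exists_correspondenceAction_act_eq_map (G : GysinFormalism) {n : ℕ}
    {X : SchemeOver ℂ} (hX : IsSmoothProjective n X) (hH : Resolution.Hironaka1964_projective.{0})
    (hM : ∀ (m : ℕ) (Y : SchemeOver ℂ), nonempty_hodgeModel m Y) (f : X ⟶ X) :
    ∃ Γf : ↥(cyclesOfDim (X ⊗ X).left n),
      ∀ r : ℕ, (G.correspondenceAction hX hH hM).act r Γf = (complexBetti.map f r).hom := by
  obtain ⟨γ, hγ⟩ := exists_isGenericPoint_graph hX hX f
  exact ⟨⟨primeCycle γ, primeCycle_graph_mem_cyclesOfDim hX hX f hγ⟩, fun r ↦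
    corrAct_primeCycle_graph G hX hX f r γ hγ _⟩

/-! ### The stub: the `C`-half of clause (K3) of `IsCorrespondencePackage` -/

/-- **Stub F1, `C`-half of clause (K3) (`[Γ_f]^* = f^*`), unconditionally.** Every smooth projective
complex variety `X` of dimension `2p` (`p ≥ 1`) carries a cohomological action of correspondences
`C : CorrespondenceAction (2p) X` — the action (10.7) `[Z]^*(c) = pr_{1*}(pr_2^* c ∪ cl Z)` of the
Gysin / cycle-class formalism of the complex orientations
(`exists_gysinFormalism_isGysinHodgeCompatible_complexOrientation_holds`), with projective Hironaka and Hodge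
models (both theorems of the tree) — under which every endomorphism `f : X ⟶ X` has a `2p`-cycle
`Γ_f` on `X × X`, the graph of `f`, acting as `f^*` on every `Hʳ(X(ℂ); ℂ)` (Fulton Prop. 16.1.2 (c):
`(Γ_f)^* = f^*`). This is the `C`-component of clause (K3) `graphs` of `IsCorrespondencePackage`
(the Chow half `(Γ_f)_* {P} = {f P}` needs the Chow action `Act`, not constructed here).
[cite: Fulton1998, Prop. 16.1.2 (c)] [cite: VoisinHodgeII2003, proof of Thm. 10.17 (10.7)] -/
theorem exists_correspondenceAction_graphs : ∀ ⦃p : ℕ⦄ ⦃X : SchemeOver ℂ⦄, 1 ≤ p → IsSmoothProjective (2 * p) X → ∃ C : CorrespondenceAction (2 * p) X, ∀ f : X ⟶ X, ∃ Γf : ↥(cyclesOfDim (X ⊗ X).left (2 * p)), ∀ r : ℕ, C.act r Γf = (complexBetti.map f r).hom := by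
  intro p X _ hX
  obtain ⟨G, -⟩ := exists_gysinFormalism_isGysinHodgeCompatible_complexOrientation_holds
  exact ⟨G.correspondenceAction hX Resolution.Hironaka1964_projective_holds
    (fun _ _ ↦ nonempty_hodgeModel_holds), fun f ↦
      exists_correspondenceAction_act_eq_map G hX Resolution.Hironaka1964_projective_holds
        (fun _ _ ↦ nonempty_hodgeModel_holds) f⟩

end Summit.HodgeConjecture.HodgeConjecture.Theorems.Ch0Null

end
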